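import Literature.NumberTheory.Sieve.NumberFieldLargeSieveCharacters
import Literature.NumberTheory.Sieve.LargeSieveCharacters
import HarnessLib

/-!
# Bilinear forms in characters of `(𝓞_K/𝔮)ˣ` with a box cross-condition (Hinz (3.5), (3.12))

Topic `Literature/NumberTheory/Sieve`; namespace `Literature.NumberTheory.Sieve.NumberFieldLS`
(continuing `NumberFieldLargeSieveCharacters.lean`).  Everything here is PROVED.

**The printed results** (J. G. Hinz, *A generalization of Bombieri's prime number theorem to
algebraic number fields*, Acta Arith. 51 (1988), §3): from the large sieve (3.1) and Cauchy's
inequality,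

  (3.5) `∑_{N𝔮≤Q} (N𝔮/Φ(𝔮)) ∑*_χ |∑'∑' c₁(α₁)c₂(α₂)χ(α₁α₂)| ≪ (Q²+x/N𝔞₁)^{1/2}(Q²+y/N𝔞₂)^{1/2} ‖c₁‖₂‖c₂‖₂`,

and, with the cross-condition (3.4) `0 < α₁^{(k)}α₂^{(k)} ≤ z_k` (all real places `k`) inside the
absolute value, the same bound up to a power of a logarithm plus the contribution of the pairs
near the boundary of the condition ((3.12): `… (log xy)^{r+1} ‖c₁‖‖c₂‖ + Q²(log xy)^{r+1}(∑'₁ + ∑'₄)|c₁c₂|`).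

**What is proved here** (totally real `K` of degree `d`; moduli `𝔮` prime to `𝔞₁𝔞₂`, coefficients
supported on finite sets `A_i ⊆ 𝔞_i` in cubes of side `2X_i` with `N𝔞_i ≤ X_i^d`):

* `bilinearLargeSieve` — (3.5): `∑_𝔮 (N𝔮/φ(𝔮)) ∑*_χ |∑_{α₁}∑_{α₂} c₁c₂χ(α₁α₂)|`
  `≤ C √((Q²+X₁^d/N𝔞₁)∑|c₁|²) √((Q²+X₂^d/N𝔞₂)∑|c₂|²)`;
* the **separation of the cross-condition without Perron's formula** (a deviation from Hinz, who
  uses the truncated integral (3.6); we copy the arithmetic device of the tree's ℤ-model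
  `Sieve/LargeSieveCharacters.lean`, §Separation): on the logarithmic scale `u(a) = ⌊T log a⌋`
  the condition `ab ≤ z` agrees with `u(a) + u(b) ≤ u(z)` except when `z < ab ≤ z e^{2/T}`
  (`mul_le_iff_of_not_shell`), and the indicator of `w ≤ Z` on `{0,…,P−1}` is the finite Fourier
  series `∑_{j<P} e(jw/P) c_j` with `|c_j| ≤ γ_j`, `∑γ_j ≤ 2 + log P` (the tree's `sepCoeff`,
  `sepWeight`); the product over the `d` real places separates `α₁` from `α₂` at the cost of the
  factor `(2 + log P)^d` (`hyperIndicator_eq_sum`);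
* **`bilinearLargeSieve_hyperbolic`** — (3.12) in this form: with the cross-condition
  `∀ k, σ_k(α₁)σ_k(α₂) ≤ z_k` (`z_k ≥ 1`, all `σ_k(α) ≥ 1`, `T > 0`, `P` above all `u`-values),
  `∑_𝔮 (N𝔮/φ(𝔮)) ∑*_χ |∑∑_{cross} c₁c₂χ(α₁α₂)| ≤ C (2 + log P)^d √(…)√(…) + (∑_𝔮 N𝔮) · ∑_{shell} |c₁||c₂|`,
  the shell being the pairs with `z_k < σ_k(α₁)σ_k(α₂) ≤ z_k e^{2/T}` for some `k` (Hinz's `∑'₄`;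
  his `∑'₁`, pairs with a coordinate product `< 1`, is empty here since all `σ_k ≥ 1`).

## References

* J. G. Hinz, Acta Arith. 51 (1988), 173–193, §3 (3.4)–(3.12). [Hinz1988]
* R. C. Vaughan, *An elementary method in prime number theory*, Acta Arith. 37 (1980), Lemma 2
  (the ℤ-model of the separation). [Vaughan1980]

## Mathlib / tree search

Tree: `NumberFieldLS.multiplicativeLargeSieve`, `msTerm(_eq,_nonneg)`, `unitValue_mul`, `remb`
(`NumberFieldLargeSieve[Characters]`); `LargeSieve.sepCoeff`, `sepWeight(_nonneg)`,
`ite_le_eq_sum_e_mul_sepCoeff`, `norm_sepCoeff_le`, `sum_sepWeight_le`, `LargeSieve.e`, `norm_e`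
(`LargeSieveCharacters`, `LargeSieveInequality`). Mathlib: `Real.sum_sqrt_mul_sqrt_le`,
`Finset.prod_univ_sum`, `Fintype.piFinset`, `Finset.prod_boole`.
-/

noncomputable section

open Complex Finset NumberField NumberField.InfinitePlace IsDedekindDomain Module
open scoped Real ComplexConjugate nonZeroDivisors Classical

namespace Literature.NumberTheory.Sieve.NumberFieldLS

open Literature.NumberTheory.Sieve.BoxPrimes (unitValue unitValue_coe unitValue_of_not_isUnit norm_unitValue_le)
open Literature.NumberTheory.LFunctions.NumberField (idealsLE mem_idealsLE)
open Literature.NumberTheory.Sieve.LargeSieve (e norm_e e_add sepCoeff sepWeight sepWeight_nonneg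
  ite_le_eq_sum_e_mul_sepCoeff norm_sepCoeff_le sum_sepWeight_le)

variable {K : Type*} [Field K] [NumberField K]

/-! ## The weighted sums over primitive characters of a bilinear form -/

variable (K) in
/-- **The `𝔮`-term of a bilinear form in characters**: `(N𝔮/φ(𝔮)) ∑*_{χ mod 𝔮} |∑_{α₁∈A₁}∑_{α₂∈A₂} F(α₁,α₂) χ(α₁α₂)|`
(a `finsum` over the primitive characters; `bTerm_eq`). [cite: Hinz1988, §3 (3.3)] -/
def bTerm (𝔮 : Ideal (𝓞 K)) (A₁ A₂ : Finset (𝓞 K)) (F : 𝓞 K → 𝓞 K → ℂ) : ℝ :=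
  (Ideal.absNorm 𝔮 : ℝ) / Nat.card ((𝓞 K ⧸ 𝔮)ˣ) *
    ∑ᶠ χ : AddChar (Additive ((𝓞 K ⧸ 𝔮)ˣ)) ℂ,
      if IsPrimitiveChar 𝔮 χ then
        ‖∑ α₁ ∈ A₁, ∑ α₂ ∈ A₂, F α₁ α₂ * unitValue χ (Ideal.Quotient.mk 𝔮 (α₁ * α₂))‖ else 0

/-- Unfolding `bTerm` for `𝔮 ≠ 0`. [folklore] -/
theorem bTerm_eq {𝔮 : Ideal (𝓞 K)} [Fintype (𝓞 K ⧸ 𝔮)] (A₁ A₂ : Finset (𝓞 K)) (F : 𝓞 K → 𝓞 K → ℂ) :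
    bTerm K 𝔮 A₁ A₂ F = (Ideal.absNorm 𝔮 : ℝ) / Fintype.card ((𝓞 K ⧸ 𝔮)ˣ) *
      ∑ χ ∈ (Finset.univ : Finset (AddChar (Additive ((𝓞 K ⧸ 𝔮)ˣ)) ℂ)).filter (IsPrimitiveChar 𝔮),
        ‖∑ α₁ ∈ A₁, ∑ α₂ ∈ A₂, F α₁ α₂ * unitValue χ (Ideal.Quotient.mk 𝔮 (α₁ * α₂))‖ := by
  haveI : Finite ((𝓞 K ⧸ 𝔮)ˣ) := inferInstance
  rw [bTerm, finsum_eq_sum_of_fintype, Finset.sum_filter, Nat.card_eq_fintype_card]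

/-- `bTerm ≥ 0`. [folklore] -/
theorem bTerm_nonneg (𝔮 : Ideal (𝓞 K)) (A₁ A₂ : Finset (𝓞 K)) (F : 𝓞 K → 𝓞 K → ℂ) :
    0 ≤ bTerm K 𝔮 A₁ A₂ F := by
  unfold bTerm
  refine mul_nonneg (by positivity) (finsum_nonneg fun χ => ?_)
  split_ifs <;> positivity

omit [NumberField K] in
/-- `χ(α₁α₂) = χ(α₁)χ(α₂)`. [folklore] -/
theorem unitValue_mk_mul {𝔮 : Ideal (𝓞 K)} (χ : AddChar (Additive ((𝓞 K ⧸ 𝔮)ˣ)) ℂ) (α₁ α₂ : 𝓞 K) :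
    unitValue χ (Ideal.Quotient.mk 𝔮 (α₁ * α₂)) =
      unitValue χ (Ideal.Quotient.mk 𝔮 α₁) * unitValue χ (Ideal.Quotient.mk 𝔮 α₂) := by
  rw [map_mul, unitValue_mul]

omit [NumberField K] in
/-- **A factorised bilinear form is a product of two linear character sums.** [folklore] -/
theorem sum_sum_mul_unitValue_eq {𝔮 : Ideal (𝓞 K)} (χ : AddChar (Additive ((𝓞 K ⧸ 𝔮)ˣ)) ℂ)
    (A₁ A₂ : Finset (𝓞 K)) (d₁ d₂ : 𝓞 K → ℂ) :
    ∑ α₁ ∈ A₁, ∑ α₂ ∈ A₂, d₁ α₁ * d₂ α₂ * unitValue χ (Ideal.Quotient.mk 𝔮 (α₁ * α₂)) =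
      (∑ α₁ ∈ A₁, d₁ α₁ * unitValue χ (Ideal.Quotient.mk 𝔮 α₁)) *
        ∑ α₂ ∈ A₂, d₂ α₂ * unitValue χ (Ideal.Quotient.mk 𝔮 α₂) := by
  rw [Finset.sum_mul_sum]
  refine Finset.sum_congr rfl fun α₁ _ => Finset.sum_congr rfl fun α₂ _ => ?_
  rw [unitValue_mk_mul]; ring

/-- **Cauchy–Schwarz for one modulus**: for a factorised form,
`bTerm 𝔮 (d₁ ⊗ d₂) ≤ √(msTerm 𝔮 d₁) √(msTerm 𝔮 d₂)`. [cite: Hinz1988, §3 (3.5)] -/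
theorem bTerm_mul_le_sqrt {𝔮 : Ideal (𝓞 K)} (h𝔮 : 𝔮 ≠ ⊥) (A₁ A₂ : Finset (𝓞 K)) (d₁ d₂ : 𝓞 K → ℂ) :
    bTerm K 𝔮 A₁ A₂ (fun α₁ α₂ => d₁ α₁ * d₂ α₂) ≤
      Real.sqrt (msTerm K 𝔮 A₁ d₁) * Real.sqrt (msTerm K 𝔮 A₂ d₂) := by
  haveI : Finite (𝓞 K ⧸ 𝔮) := Ideal.finiteQuotientOfFreeOfNeBot 𝔮 h𝔮
  haveI : Fintype (𝓞 K ⧸ 𝔮) := Fintype.ofFinite _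
  set w : ℝ := (Ideal.absNorm 𝔮 : ℝ) / Fintype.card ((𝓞 K ⧸ 𝔮)ˣ) with hw
  have hw0 : 0 ≤ w := by positivity
  set Pr := (Finset.univ : Finset (AddChar (Additive ((𝓞 K ⧸ 𝔮)ˣ)) ℂ)).filter (IsPrimitiveChar 𝔮) with hPr
  set S₁ : AddChar (Additive ((𝓞 K ⧸ 𝔮)ˣ)) ℂ → ℂ := fun χ => ∑ α₁ ∈ A₁, d₁ α₁ * unitValue χ (Ideal.Quotient.mk 𝔮 α₁)
  set S₂ : AddChar (Additive ((𝓞 K ⧸ 𝔮)ˣ)) ℂ → ℂ := fun χ => ∑ α₂ ∈ A₂, d₂ α₂ * unitValue χ (Ideal.Quotient.mk 𝔮 α₂)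
  rw [bTerm_eq, msTerm_eq, msTerm_eq, ← hw, ← hPr]
  rw [Finset.sum_congr rfl fun χ _ => by rw [sum_sum_mul_unitValue_eq χ A₁ A₂ d₁ d₂, norm_mul]]
  rw [Finset.mul_sum, Finset.mul_sum, Finset.mul_sum]
  have h1 : ∀ χ ∈ Pr, w * (‖S₁ χ‖ * ‖S₂ χ‖) = Real.sqrt (w * ‖S₁ χ‖ ^ 2) * Real.sqrt (w * ‖S₂ χ‖ ^ 2) := by
    intro χ _
    rw [Real.sqrt_mul hw0, Real.sqrt_mul hw0, Real.sqrt_sq (norm_nonneg _), Real.sqrt_sq (norm_nonneg _),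
      show Real.sqrt w * ‖S₁ χ‖ * (Real.sqrt w * ‖S₂ χ‖) = (Real.sqrt w * Real.sqrt w) * (‖S₁ χ‖ * ‖S₂ χ‖) by ring,
      Real.mul_self_sqrt hw0]
  rw [Finset.sum_congr rfl h1]
  exact Real.sum_sqrt_mul_sqrt_le Pr (fun χ => by positivity) (fun χ => by positivity)

/-- **Cauchy–Schwarz over the moduli**: `∑ √(a_𝔮) √(b_𝔮) ≤ √(∑ a) √(∑ b)`. [folklore] -/
theorem sum_bTerm_mul_le_sqrt (𝒬 : Finset (Ideal (𝓞 K))) (h𝒬 : ∀ 𝔮 ∈ 𝒬, 𝔮 ≠ ⊥) (A₁ A₂ : Finset (𝓞 K))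
    (d₁ d₂ : 𝓞 K → ℂ) :
    ∑ 𝔮 ∈ 𝒬, bTerm K 𝔮 A₁ A₂ (fun α₁ α₂ => d₁ α₁ * d₂ α₂) ≤
      Real.sqrt (∑ 𝔮 ∈ 𝒬, msTerm K 𝔮 A₁ d₁) * Real.sqrt (∑ 𝔮 ∈ 𝒬, msTerm K 𝔮 A₂ d₂) := by
  calc ∑ 𝔮 ∈ 𝒬, bTerm K 𝔮 A₁ A₂ (fun α₁ α₂ => d₁ α₁ * d₂ α₂)
      ≤ ∑ 𝔮 ∈ 𝒬, Real.sqrt (msTerm K 𝔮 A₁ d₁) * Real.sqrt (msTerm K 𝔮 A₂ d₂) :=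
        Finset.sum_le_sum fun 𝔮 h𝔮 => bTerm_mul_le_sqrt (h𝒬 𝔮 h𝔮) A₁ A₂ d₁ d₂
    _ ≤ Real.sqrt (∑ 𝔮 ∈ 𝒬, msTerm K 𝔮 A₁ d₁) * Real.sqrt (∑ 𝔮 ∈ 𝒬, msTerm K 𝔮 A₂ d₂) :=
        Real.sum_sqrt_mul_sqrt_le 𝒬 (fun 𝔮 => msTerm_nonneg K 𝔮 A₁ d₁) (fun 𝔮 => msTerm_nonneg K 𝔮 A₂ d₂)

/-! ## (3.5): the bilinear large sieve -/

section Bilinear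

variable [IsTotallyReal K]

/-- **Hinz (3.5) — the bilinear large sieve over a totally real field**, cube boxes: there is
`C = C(K) > 0` such that for all `Q ≥ 1`, nonzero `𝔞₁, 𝔞₂`, finite `A_i ⊆ 𝔞_i` in cubes of side
`2X_i` with `N𝔞_i ≤ X_i^d`, and all coefficients `d₁, d₂`,
`∑_{N𝔮≤Q, (𝔮,𝔞₁𝔞₂)=1} (N𝔮/φ(𝔮)) ∑*_χ |∑_{α₁}∑_{α₂} d₁(α₁)d₂(α₂)χ(α₁α₂)|`
`≤ C √((Q² + X₁^d/N𝔞₁)∑|d₁|²) √((Q² + X₂^d/N𝔞₂)∑|d₂|²)`. [cite: Hinz1988, §3 (3.5)] -/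
theorem bilinearLargeSieve : ∃ C : ℝ, 0 < C ∧ ∀ (Q : ℝ), 1 ≤ Q → ∀ (𝔞₁ 𝔞₂ : Ideal (𝓞 K)), 𝔞₁ ≠ ⊥ → 𝔞₂ ≠ ⊥ →
    ∀ (A₁ A₂ : Finset (𝓞 K)), (∀ α ∈ A₁, α ∈ 𝔞₁) → (∀ α ∈ A₂, α ∈ 𝔞₂) →
    ∀ (cen₁ cen₂ : {w : InfinitePlace K // w.IsReal} → ℝ) (X₁ X₂ : ℝ), 0 < X₁ → 0 < X₂ →
    (Ideal.absNorm 𝔞₁ : ℝ) ≤ X₁ ^ finrank ℚ K → (Ideal.absNorm 𝔞₂ : ℝ) ≤ X₂ ^ finrank ℚ K →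
    (∀ α ∈ A₁, ∀ k, |remb K (α : K) k - cen₁ k| ≤ X₁) → (∀ α ∈ A₂, ∀ k, |remb K (α : K) k - cen₂ k| ≤ X₂) →
    ∀ (d₁ d₂ : 𝓞 K → ℂ),
    ∑ 𝔮 ∈ (idealsLE K Q).filter (fun 𝔮 => IsCoprime 𝔮 𝔞₁ ∧ IsCoprime 𝔮 𝔞₂),
        bTerm K 𝔮 A₁ A₂ (fun α₁ α₂ => d₁ α₁ * d₂ α₂) ≤
      C * Real.sqrt ((Q ^ 2 + X₁ ^ finrank ℚ K / Ideal.absNorm 𝔞₁) * ∑ α ∈ A₁, ‖d₁ α‖ ^ 2) *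
        Real.sqrt ((Q ^ 2 + X₂ ^ finrank ℚ K / Ideal.absNorm 𝔞₂) * ∑ α ∈ A₂, ‖d₂ α‖ ^ 2) := by
  obtain ⟨C, hC, hLS⟩ := multiplicativeLargeSieve (K := K)
  refine ⟨C, hC, ?_⟩
  intro Q hQ 𝔞₁ 𝔞₂ h𝔞₁ h𝔞₂ A₁ A₂ hA₁ hA₂ cen₁ cen₂ X₁ X₂ hX₁ hX₂ hN₁ hN₂ hbox₁ hbox₂ d₁ d₂
  set 𝒬 := (idealsLE K Q).filter (fun 𝔮 => IsCoprime 𝔮 𝔞₁ ∧ IsCoprime 𝔮 𝔞₂) with h𝒬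
  have h𝒬0 : ∀ 𝔮 ∈ 𝒬, 𝔮 ≠ ⊥ := fun 𝔮 h => (mem_idealsLE.1 (Finset.mem_filter.1 h).1).1
  have h1 := hLS Q hQ 𝔞₁ h𝔞₁ A₁ hA₁ cen₁ X₁ hX₁ hN₁ hbox₁ d₁
  have h2 := hLS Q hQ 𝔞₂ h𝔞₂ A₂ hA₂ cen₂ X₂ hX₂ hN₂ hbox₂ d₂
  -- the sums over `𝒬` are sums over subsets of the coprime-to-`𝔞_i` moduli
  have hsub : ∀ i : Fin 2, 𝒬 ⊆ (idealsLE K Q).filter (fun 𝔮 => IsCoprime 𝔮 (if i = 0 then 𝔞₁ else 𝔞₂)) := by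
    intro i 𝔮 h𝔮
    rw [h𝒬, Finset.mem_filter] at h𝔮
    rw [Finset.mem_filter]
    refine ⟨h𝔮.1, ?_⟩
    split_ifs
    · exact h𝔮.2.1
    · exact h𝔮.2.2
  have hle1 : ∑ 𝔮 ∈ 𝒬, msTerm K 𝔮 A₁ d₁ ≤
      C * (Q ^ 2 + X₁ ^ finrank ℚ K / Ideal.absNorm 𝔞₁) * ∑ α ∈ A₁, ‖d₁ α‖ ^ 2 :=
    (Finset.sum_le_sum_of_subset_of_nonneg (hsub 0) fun 𝔮 _ _ => msTerm_nonneg K 𝔮 A₁ d₁).trans (by simpa using h1)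
  have hle2 : ∑ 𝔮 ∈ 𝒬, msTerm K 𝔮 A₂ d₂ ≤
      C * (Q ^ 2 + X₂ ^ finrank ℚ K / Ideal.absNorm 𝔞₂) * ∑ α ∈ A₂, ‖d₂ α‖ ^ 2 :=
    (Finset.sum_le_sum_of_subset_of_nonneg (hsub 1) fun 𝔮 _ _ => msTerm_nonneg K 𝔮 A₂ d₂).trans (by simpa using h2)
  refine (sum_bTerm_mul_le_sqrt 𝒬 h𝒬0 A₁ A₂ d₁ d₂).trans ?_
  have hs0 : 0 ≤ ∑ 𝔮 ∈ 𝒬, msTerm K 𝔮 A₁ d₁ := Finset.sum_nonneg fun 𝔮 _ => msTerm_nonneg K 𝔮 A₁ d₁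
  calc Real.sqrt (∑ 𝔮 ∈ 𝒬, msTerm K 𝔮 A₁ d₁) * Real.sqrt (∑ 𝔮 ∈ 𝒬, msTerm K 𝔮 A₂ d₂)
      ≤ Real.sqrt (C * (Q ^ 2 + X₁ ^ finrank ℚ K / Ideal.absNorm 𝔞₁) * ∑ α ∈ A₁, ‖d₁ α‖ ^ 2) *
        Real.sqrt (C * (Q ^ 2 + X₂ ^ finrank ℚ K / Ideal.absNorm 𝔞₂) * ∑ α ∈ A₂, ‖d₂ α‖ ^ 2) :=
        mul_le_mul (Real.sqrt_le_sqrt hle1) (Real.sqrt_le_sqrt hle2) (Real.sqrt_nonneg _) (Real.sqrt_nonneg _)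
    _ = C * Real.sqrt ((Q ^ 2 + X₁ ^ finrank ℚ K / Ideal.absNorm 𝔞₁) * ∑ α ∈ A₁, ‖d₁ α‖ ^ 2) *
        Real.sqrt ((Q ^ 2 + X₂ ^ finrank ℚ K / Ideal.absNorm 𝔞₂) * ∑ α ∈ A₂, ‖d₂ α‖ ^ 2) := by
        rw [mul_assoc C, mul_assoc C, Real.sqrt_mul hC.le, Real.sqrt_mul hC.le]
        have hCC : Real.sqrt C * Real.sqrt C = C := Real.mul_self_sqrt hC.le
        calc Real.sqrt C * Real.sqrt ((Q ^ 2 + X₁ ^ finrank ℚ K / Ideal.absNorm 𝔞₁) * ∑ α ∈ A₁, ‖d₁ α‖ ^ 2) *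
              (Real.sqrt C * Real.sqrt ((Q ^ 2 + X₂ ^ finrank ℚ K / Ideal.absNorm 𝔞₂) * ∑ α ∈ A₂, ‖d₂ α‖ ^ 2))
            = (Real.sqrt C * Real.sqrt C) *
                (Real.sqrt ((Q ^ 2 + X₁ ^ finrank ℚ K / Ideal.absNorm 𝔞₁) * ∑ α ∈ A₁, ‖d₁ α‖ ^ 2) *
                  Real.sqrt ((Q ^ 2 + X₂ ^ finrank ℚ K / Ideal.absNorm 𝔞₂) * ∑ α ∈ A₂, ‖d₂ α‖ ^ 2)) := by ring
          _ = _ := by rw [hCC]; ring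

end Bilinear

/-! ## Separation of the cross-condition on the logarithmic scale -/

section Separation

/-- The logarithmic scale `u_T(a) = ⌊T log a⌋` (for reals `a ≥ 1`). [folklore] -/
def ulogR (T a : ℝ) : ℕ := ⌊T * Real.log a⌋₊

/-- `u_T(a) ≤ T log a` for `a ≥ 1`, `T ≥ 0`. [folklore] -/
theorem ulogR_le {T a : ℝ} (hT : 0 ≤ T) (ha : 1 ≤ a) : (ulogR T a : ℝ) ≤ T * Real.log a :=
  Nat.floor_le (mul_nonneg hT (Real.log_nonneg ha))

/-- `T log a < u_T(a) + 1`. [folklore] -/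
theorem lt_ulogR_add_one (T a : ℝ) : T * Real.log a < (ulogR T a : ℝ) + 1 := Nat.lt_floor_add_one _

/-- **Agreement of `ab ≤ z` with `u(a) + u(b) ≤ u(z)` off the shell `z < ab ≤ z e^{2/T}`**
(`a, b, z ≥ 1`, `T > 0`). [cite: Vaughan1980, Lemma 2] -/
theorem mul_le_iff_of_not_shell {T a b z : ℝ} (hT : 0 < T) (ha : 1 ≤ a) (hb : 1 ≤ b) (hz : 1 ≤ z)
    (hshell : ¬ (z < a * b ∧ a * b ≤ z * Real.exp (2 / T))) :
    a * b ≤ z ↔ ulogR T a + ulogR T b ≤ ulogR T z := by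
  have hab : 1 ≤ a * b := one_le_mul_of_one_le_of_one_le ha hb
  have hlog : Real.log (a * b) = Real.log a + Real.log b :=
    Real.log_mul (by linarith) (by linarith)
  constructor
  · intro h
    have h1 : (ulogR T a : ℝ) + ulogR T b ≤ T * Real.log z := by
      calc (ulogR T a : ℝ) + ulogR T b ≤ T * Real.log a + T * Real.log b := add_le_add (ulogR_le hT.le ha) (ulogR_le hT.le hb)
        _ = T * Real.log (a * b) := by rw [hlog]; ring
        _ ≤ T * Real.log z := by gcongr
    have h2 := lt_ulogR_add_one T z
    have : (ulogR T a + ulogR T b : ℕ) < ulogR T z + 1 := by exact_mod_cast (by push_cast; linarith : ((ulogR T a + ulogR T b : ℕ) : ℝ) < ulogR T z + 1)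
    omega
  · intro h
    by_contra hgt
    push Not at hgt
    have hbig : z * Real.exp (2 / T) < a * b := by
      by_contra hle; push Not at hle
      exact hshell ⟨hgt, hle⟩
    have hz0 : 0 < z := by linarith
    have h3 : T * Real.log z + 2 < T * Real.log (a * b) := by
      have := Real.log_lt_log (by positivity) hbig
      rw [Real.log_mul hz0.ne' (Real.exp_pos _).ne', Real.log_exp] at this
      have h4 : T * (Real.log z + 2 / T) < T * Real.log (a * b) := mul_lt_mul_of_pos_left this hT
      have : T * (Real.log z + 2 / T) = T * Real.log z + 2 := by field_simp
      linarith
    have h5 : T * Real.log (a * b) < (ulogR T a : ℝ) + ulogR T b + 2 := by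
      rw [hlog, mul_add]
      linarith [lt_ulogR_add_one T a, lt_ulogR_add_one T b]
    have h6 : (ulogR T z : ℝ) ≤ T * Real.log z := ulogR_le hT.le hz
    have h7 : (ulogR T z : ℝ) < ulogR T a + ulogR T b := by linarith
    have : ulogR T z < ulogR T a + ulogR T b := by exact_mod_cast h7
    omega

variable {ι : Type*} [Fintype ι] [DecidableEq ι]

/-- The separated phase `t_j(w) = ∏_k e(j_k w_k / P)` of a vector of integers. [folklore] -/
def sepPhase (P : ℕ) (j w : ι → ℕ) : ℂ := ∏ k, e ((j k : ℝ) * (w k : ℝ) / P)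

omit [DecidableEq ι] in
/-- `|t_j(w)| = 1`. [folklore] -/
theorem norm_sepPhase (P : ℕ) (j w : ι → ℕ) : ‖sepPhase P j w‖ = 1 := by
  unfold sepPhase
  rw [norm_prod]
  exact Finset.prod_eq_one fun k _ => norm_e _

/-- **Separation of a box condition in several variables**: for vectors of integers
`w₁, w₂, Z` with `w₁ₖ + w₂ₖ < P` and `Z_k < P`,
`[∀ k, w₁ₖ + w₂ₖ ≤ Z_k] = ∑_{j ∈ [0,P)^ι} (∏_k c_{j_k}(Z_k)) t_j(w₁) t_j(w₂)`.
[cite: Vaughan1980, Lemma 2] -/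
theorem hyperIndicator_eq_sum {P : ℕ} (w₁ w₂ Z : ι → ℕ) (hw : ∀ k, w₁ k + w₂ k < P) (hZ : ∀ k, Z k < P) :
    (if ∀ k, w₁ k + w₂ k ≤ Z k then (1 : ℂ) else 0) =
      ∑ j ∈ Fintype.piFinset (fun _ : ι => Finset.range P),
        (∏ k, sepCoeff P (Z k) (j k)) * (sepPhase P j w₁ * sepPhase P j w₂) := by
  have hprod : (if ∀ k, w₁ k + w₂ k ≤ Z k then (1 : ℂ) else 0) = ∏ k, if w₁ k + w₂ k ≤ Z k then (1 : ℂ) else 0 := by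
    rw [Finset.prod_boole]; simp
  rw [hprod, Finset.prod_congr rfl fun k _ => ite_le_eq_sum_e_mul_sepCoeff (hw k) (hZ k)]
  rw [Finset.prod_univ_sum]
  refine Finset.sum_congr rfl fun j _ => ?_
  rw [sepPhase, sepPhase, ← Finset.prod_mul_distrib, ← Finset.prod_mul_distrib]
  refine Finset.prod_congr rfl fun k _ => ?_
  rw [← e_add]
  have : (j k : ℝ) * (w₁ k : ℝ) / P + (j k : ℝ) * (w₂ k : ℝ) / P = (j k : ℝ) * ((w₁ k + w₂ k : ℕ) : ℝ) / P := by
    push_cast; ring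
  rw [this]; ring

/-- **The separation weights multiply out**: `∑_{j ∈ [0,P)^ι} ∏_k γ_{j_k} = (∑_{j<P} γ_j)^{#ι} ≤ (2 + log P)^{#ι}`.
[folklore] -/
theorem sum_prod_sepWeight_le {P : ℕ} (hP : 0 < P) :
    ∑ j ∈ Fintype.piFinset (fun _ : ι => Finset.range P), ∏ k, sepWeight P (j k) ≤
      (2 + Real.log P) ^ Fintype.card ι := by
  rw [← Finset.prod_univ_sum (fun _ : ι => Finset.range P) (fun _ j => sepWeight P j), Finset.prod_const,
    Finset.card_univ]
  exact pow_le_pow_left₀ (Finset.sum_nonneg fun j _ => sepWeight_nonneg P j) (sum_sepWeight_le hP) _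

end Separation

/-! ## (3.12): the bilinear large sieve with the box cross-condition -/

section Hyperbolic

variable [IsTotallyReal K]

/-- The cross-condition `σ_k(α₁) σ_k(α₂) ≤ z_k` at every real place (Hinz (3.4) for totally real `K`).
[cite: Hinz1988, §3 (3.4)] -/
def Cross (z : {w : InfinitePlace K // w.IsReal} → ℝ) (α₁ α₂ : 𝓞 K) : Prop :=
  ∀ k, remb K (α₁ : K) k * remb K (α₂ : K) k ≤ z k

/-- The shell of the cross-condition at scale `T`: `z_k < σ_k(α₁)σ_k(α₂) ≤ z_k e^{2/T}` for some `k`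
(Hinz's `∑'₄`). [cite: Hinz1988, §3 (after (3.11))] -/
def Shell (z : {w : InfinitePlace K // w.IsReal} → ℝ) (T : ℝ) (α₁ α₂ : 𝓞 K) : Prop :=
  ∃ k, z k < remb K (α₁ : K) k * remb K (α₂ : K) k ∧
    remb K (α₁ : K) k * remb K (α₂ : K) k ≤ z k * Real.exp (2 / T)

/-- The discretised coordinates `u_T(σ_k(α))`. [folklore] -/
def ulogV (T : ℝ) (α : 𝓞 K) : {w : InfinitePlace K // w.IsReal} → ℕ := fun k => ulogR T (remb K (α : K) k)

omit [NumberField K] [IsTotallyReal K] in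
/-- **Off the shell, the cross-condition is the discretised condition.** [cite: Vaughan1980, Lemma 2] -/
theorem cross_iff_of_not_shell {z : {w : InfinitePlace K // w.IsReal} → ℝ} {T : ℝ} (hT : 0 < T)
    (hz : ∀ k, 1 ≤ z k) {α₁ α₂ : 𝓞 K} (h₁ : ∀ k, 1 ≤ remb K (α₁ : K) k) (h₂ : ∀ k, 1 ≤ remb K (α₂ : K) k)
    (hs : ¬ Shell z T α₁ α₂) :
    Cross z α₁ α₂ ↔ ∀ k, ulogV T α₁ k + ulogV T α₂ k ≤ ulogR T (z k) := by
  unfold Shell at hs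
  push Not at hs
  refine forall_congr' fun k => ?_
  exact mul_le_iff_of_not_shell hT (h₁ k) (h₂ k) (hz k) (fun h => (hs k h.1).not_ge h.2)

/-- The shell sum `∑_{shell} |c₁(α₁)||c₂(α₂)|`. [cite: Hinz1988, §3 (∑'₄)] -/
def shellSum (A₁ A₂ : Finset (𝓞 K)) (z : {w : InfinitePlace K // w.IsReal} → ℝ) (T : ℝ) (c₁ c₂ : 𝓞 K → ℂ) : ℝ :=
  ∑ α₁ ∈ A₁, ∑ α₂ ∈ A₂, if Shell z T α₁ α₂ then ‖c₁ α₁‖ * ‖c₂ α₂‖ else 0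

omit [IsTotallyReal K] in
/-- `shellSum ≥ 0`. [folklore] -/
theorem shellSum_nonneg (A₁ A₂ : Finset (𝓞 K)) (z : {w : InfinitePlace K // w.IsReal} → ℝ) (T : ℝ)
    (c₁ c₂ : 𝓞 K → ℂ) : 0 ≤ shellSum A₁ A₂ z T c₁ c₂ :=
  Finset.sum_nonneg fun _ _ => Finset.sum_nonneg fun _ _ => by unfold Shell; split_ifs <;> positivity

/-- The indicator of the cross-condition. [folklore] -/
def crossInd (z : {w : InfinitePlace K // w.IsReal} → ℝ) (α₁ α₂ : 𝓞 K) : ℂ := if Cross z α₁ α₂ then 1 else 0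

/-- The indicator of the discretised condition `u(α₁) + u(α₂) ≤ Z`. [folklore] -/
def dcrossInd (T : ℝ) (Zv : {w : InfinitePlace K // w.IsReal} → ℕ) (α₁ α₂ : 𝓞 K) : ℂ :=
  if ∀ k, ulogV T α₁ k + ulogV T α₂ k ≤ Zv k then 1 else 0

omit [NumberField K] [IsTotallyReal K] in
/-- The cross-conditioned coefficient through the indicator. [folklore] -/
theorem ite_cross_eq (z : {w : InfinitePlace K // w.IsReal} → ℝ) (c₁ c₂ : 𝓞 K → ℂ) (α₁ α₂ : 𝓞 K) :
    (if Cross z α₁ α₂ then c₁ α₁ * c₂ α₂ else 0) = crossInd z α₁ α₂ * (c₁ α₁ * c₂ α₂) := by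
  unfold crossInd; split_ifs <;> simp

omit [IsTotallyReal K] in
/-- **Off the shell the two indicators agree; on it they differ by at most `1`.** [cite: Vaughan1980, Lemma 2] -/
theorem norm_crossInd_sub_dcrossInd_le {z : {w : InfinitePlace K // w.IsReal} → ℝ} (hz : ∀ k, 1 ≤ z k) {T : ℝ}
    (hT : 0 < T) {α₁ α₂ : 𝓞 K} (h₁ : ∀ k, 1 ≤ remb K (α₁ : K) k) (h₂ : ∀ k, 1 ≤ remb K (α₂ : K) k) :
    ‖crossInd z α₁ α₂ - dcrossInd T (fun k => ulogR T (z k)) α₁ α₂‖ ≤ if Shell z T α₁ α₂ then 1 else 0 := by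
  unfold crossInd dcrossInd
  by_cases hs : Shell z T α₁ α₂
  · rw [if_pos hs]
    split_ifs <;> simp
  · rw [if_neg hs]
    have hiff := cross_iff_of_not_shell hT hz h₁ h₂ hs
    by_cases hc : Cross z α₁ α₂
    · rw [if_pos hc, if_pos (hiff.1 hc), sub_self, norm_zero]
    · rw [if_neg hc, if_neg (fun h => hc (hiff.2 h)), sub_self, norm_zero]

omit [NumberField K] [IsTotallyReal K] in
/-- Interchanging a double sum with a separated expansion:
`∑_{α₁}∑_{α₂} (∑_j g_j φ_j(α₁)ψ_j(α₂)) h(α₁,α₂) = ∑_j g_j ∑_{α₁}∑_{α₂} φ_j(α₁)ψ_j(α₂)h(α₁,α₂)`. [folklore] -/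
theorem sum_sum_sum_mul_eq {J : Type*} (Js : Finset J) (A₁ A₂ : Finset (𝓞 K)) (g : J → ℂ)
    (φ ψ : J → 𝓞 K → ℂ) (h : 𝓞 K → 𝓞 K → ℂ) :
    ∑ α₁ ∈ A₁, ∑ α₂ ∈ A₂, (∑ j ∈ Js, g j * (φ j α₁ * ψ j α₂)) * h α₁ α₂ =
      ∑ j ∈ Js, g j * ∑ α₁ ∈ A₁, ∑ α₂ ∈ A₂, φ j α₁ * ψ j α₂ * h α₁ α₂ := by
  have h1 : ∀ α₁ α₂, (∑ j ∈ Js, g j * (φ j α₁ * ψ j α₂)) * h α₁ α₂ =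
      ∑ j ∈ Js, g j * (φ j α₁ * ψ j α₂ * h α₁ α₂) := by
    intro α₁ α₂
    rw [Finset.sum_mul]
    exact Finset.sum_congr rfl fun j _ => by ring
  calc ∑ α₁ ∈ A₁, ∑ α₂ ∈ A₂, (∑ j ∈ Js, g j * (φ j α₁ * ψ j α₂)) * h α₁ α₂
      = ∑ α₁ ∈ A₁, ∑ α₂ ∈ A₂, ∑ j ∈ Js, g j * (φ j α₁ * ψ j α₂ * h α₁ α₂) :=
        Finset.sum_congr rfl fun α₁ _ => Finset.sum_congr rfl fun α₂ _ => h1 α₁ α₂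
    _ = ∑ α₁ ∈ A₁, ∑ j ∈ Js, ∑ α₂ ∈ A₂, g j * (φ j α₁ * ψ j α₂ * h α₁ α₂) :=
        Finset.sum_congr rfl fun α₁ _ => Finset.sum_comm
    _ = ∑ j ∈ Js, ∑ α₁ ∈ A₁, ∑ α₂ ∈ A₂, g j * (φ j α₁ * ψ j α₂ * h α₁ α₂) := Finset.sum_comm
    _ = ∑ j ∈ Js, g j * ∑ α₁ ∈ A₁, ∑ α₂ ∈ A₂, φ j α₁ * ψ j α₂ * h α₁ α₂ := by
        refine Finset.sum_congr rfl fun j _ => ?_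
        rw [Finset.mul_sum]
        refine Finset.sum_congr rfl fun α₁ _ => ?_
        rw [Finset.mul_sum]

omit [IsTotallyReal K] in
/-- **The discretised part, separated**: for a character `χ`,
`∑∑ D(α₁,α₂) c₁c₂ χ(α₁α₂) = ∑_j (∏_k c_{j_k}(Z_k)) S₁(j,χ) S₂(j,χ)`. [cite: Hinz1988, §3 (3.12)] -/
theorem sum_sum_dcrossInd_eq {𝔮 : Ideal (𝓞 K)} (χ : AddChar (Additive ((𝓞 K ⧸ 𝔮)ˣ)) ℂ) (A₁ A₂ : Finset (𝓞 K))
    {T : ℝ} {Zv : {w : InfinitePlace K // w.IsReal} → ℕ} {P : ℕ}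
    (hPu : ∀ α₁ ∈ A₁, ∀ α₂ ∈ A₂, ∀ k, ulogV T α₁ k + ulogV T α₂ k < P) (hPz : ∀ k, Zv k < P)
    (c₁ c₂ : 𝓞 K → ℂ) :
    ∑ α₁ ∈ A₁, ∑ α₂ ∈ A₂, dcrossInd T Zv α₁ α₂ * (c₁ α₁ * c₂ α₂) * unitValue χ (Ideal.Quotient.mk 𝔮 (α₁ * α₂)) =
      ∑ j ∈ Fintype.piFinset (fun _ : {w : InfinitePlace K // w.IsReal} => Finset.range P),
        (∏ k, sepCoeff P (Zv k) (j k)) *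
          ((∑ α₁ ∈ A₁, c₁ α₁ * sepPhase P j (ulogV T α₁) * unitValue χ (Ideal.Quotient.mk 𝔮 α₁)) *
            ∑ α₂ ∈ A₂, c₂ α₂ * sepPhase P j (ulogV T α₂) * unitValue χ (Ideal.Quotient.mk 𝔮 α₂)) := by
  set Js := Fintype.piFinset (fun _ : {w : InfinitePlace K // w.IsReal} => Finset.range P) with hJs
  set g : ({w : InfinitePlace K // w.IsReal} → ℕ) → ℂ := fun j => ∏ k, sepCoeff P (Zv k) (j k) with hg
  set φ : ({w : InfinitePlace K // w.IsReal} → ℕ) → 𝓞 K → ℂ := fun j α => sepPhase P j (ulogV T α) with hφ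
  set h : 𝓞 K → 𝓞 K → ℂ := fun α₁ α₂ => c₁ α₁ * c₂ α₂ * unitValue χ (Ideal.Quotient.mk 𝔮 (α₁ * α₂)) with hh
  have hre : ∀ α₁ ∈ A₁, ∀ α₂ ∈ A₂,
      dcrossInd T Zv α₁ α₂ * (c₁ α₁ * c₂ α₂) * unitValue χ (Ideal.Quotient.mk 𝔮 (α₁ * α₂)) =
      (∑ j ∈ Js, g j * (φ j α₁ * φ j α₂)) * h α₁ α₂ := by
    intro α₁ hα₁ α₂ hα₂
    rw [dcrossInd, hyperIndicator_eq_sum _ _ _ (hPu α₁ hα₁ α₂ hα₂) hPz, mul_assoc]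
  rw [Finset.sum_congr rfl fun α₁ hα₁ => Finset.sum_congr rfl fun α₂ hα₂ => hre α₁ hα₁ α₂ hα₂,
    sum_sum_sum_mul_eq Js A₁ A₂ g φ φ h]
  refine Finset.sum_congr rfl fun j _ => ?_
  rw [← sum_sum_mul_unitValue_eq χ A₁ A₂ (fun α => c₁ α * φ j α) (fun α => c₂ α * φ j α)]
  refine congrArg (fun t => g j * t) (Finset.sum_congr rfl fun α₁ _ => Finset.sum_congr rfl fun α₂ _ => ?_)
  simp only [hh]
  ring

omit [IsTotallyReal K] in
/-- The shell correction is bounded by the shell sum. [cite: Hinz1988, §3 (∑'₄)] -/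
theorem norm_sum_sum_shell_le {𝔮 : Ideal (𝓞 K)} [Finite ((𝓞 K ⧸ 𝔮)ˣ)] (χ : AddChar (Additive ((𝓞 K ⧸ 𝔮)ˣ)) ℂ)
    (A₁ A₂ : Finset (𝓞 K)) {z : {w : InfinitePlace K // w.IsReal} → ℝ} (hz : ∀ k, 1 ≤ z k) {T : ℝ} (hT : 0 < T)
    (h₁ : ∀ α ∈ A₁, ∀ k, 1 ≤ remb K (α : K) k) (h₂ : ∀ α ∈ A₂, ∀ k, 1 ≤ remb K (α : K) k) (c₁ c₂ : 𝓞 K → ℂ) :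
    ‖∑ α₁ ∈ A₁, ∑ α₂ ∈ A₂, (crossInd z α₁ α₂ - dcrossInd T (fun k => ulogR T (z k)) α₁ α₂) * (c₁ α₁ * c₂ α₂) *
        unitValue χ (Ideal.Quotient.mk 𝔮 (α₁ * α₂))‖ ≤ shellSum A₁ A₂ z T c₁ c₂ := by
  unfold shellSum
  refine (norm_sum_le _ _).trans (Finset.sum_le_sum fun α₁ hα₁ => (norm_sum_le _ _).trans
    (Finset.sum_le_sum fun α₂ hα₂ => ?_))
  rw [norm_mul, norm_mul]
  calc ‖crossInd z α₁ α₂ - dcrossInd T (fun k => ulogR T (z k)) α₁ α₂‖ * ‖c₁ α₁ * c₂ α₂‖ *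
        ‖unitValue χ (Ideal.Quotient.mk 𝔮 (α₁ * α₂))‖
      ≤ (if Shell z T α₁ α₂ then 1 else 0) * ‖c₁ α₁ * c₂ α₂‖ * 1 :=
        mul_le_mul (mul_le_mul_of_nonneg_right (norm_crossInd_sub_dcrossInd_le hz hT (h₁ α₁ hα₁) (h₂ α₂ hα₂))
          (norm_nonneg _)) (norm_unitValue_le χ _) (norm_nonneg _) (by positivity)
    _ = if Shell z T α₁ α₂ then ‖c₁ α₁‖ * ‖c₂ α₂‖ else 0 := by
        rw [norm_mul]; split_ifs <;> ring

omit [IsTotallyReal K] in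
/-- **One character: the cross-conditioned bilinear sum, separated.** For a character `χ`,
thresholds `z_k ≥ 1`, coordinates `σ_k(α) ≥ 1`, `T > 0` and `P` above all `u`-values,
`|∑∑_{cross} c₁c₂χ(α₁α₂)| ≤ ∑_j (∏γ_{j_k}) |S₁(j)||S₂(j)| + ∑_{shell} |c₁||c₂|`, where
`S_i(j) = ∑_{α} c_i(α) t_j(u(α)) χ(α)`. [cite: Hinz1988, §3 (3.12)] -/
theorem norm_cross_sum_le {𝔮 : Ideal (𝓞 K)} [Finite ((𝓞 K ⧸ 𝔮)ˣ)] (χ : AddChar (Additive ((𝓞 K ⧸ 𝔮)ˣ)) ℂ)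
    (A₁ A₂ : Finset (𝓞 K)) {z : {w : InfinitePlace K // w.IsReal} → ℝ} (hz : ∀ k, 1 ≤ z k) {T : ℝ} (hT : 0 < T)
    {P : ℕ} (h₁ : ∀ α ∈ A₁, ∀ k, 1 ≤ remb K (α : K) k) (h₂ : ∀ α ∈ A₂, ∀ k, 1 ≤ remb K (α : K) k)
    (hPu : ∀ α₁ ∈ A₁, ∀ α₂ ∈ A₂, ∀ k, ulogV T α₁ k + ulogV T α₂ k < P) (hPz : ∀ k, ulogR T (z k) < P)
    (c₁ c₂ : 𝓞 K → ℂ) :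
    ‖∑ α₁ ∈ A₁, ∑ α₂ ∈ A₂, (if Cross z α₁ α₂ then c₁ α₁ * c₂ α₂ else 0) *
        unitValue χ (Ideal.Quotient.mk 𝔮 (α₁ * α₂))‖ ≤
      (∑ j ∈ Fintype.piFinset (fun _ : {w : InfinitePlace K // w.IsReal} => Finset.range P),
        (∏ k, sepWeight P (j k)) *
          (‖∑ α₁ ∈ A₁, c₁ α₁ * sepPhase P j (ulogV T α₁) * unitValue χ (Ideal.Quotient.mk 𝔮 α₁)‖ *
            ‖∑ α₂ ∈ A₂, c₂ α₂ * sepPhase P j (ulogV T α₂) * unitValue χ (Ideal.Quotient.mk 𝔮 α₂)‖)) +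
      shellSum A₁ A₂ z T c₁ c₂ := by
  set Zv : {w : InfinitePlace K // w.IsReal} → ℕ := fun k => ulogR T (z k) with hZv
  have hsplit : ∀ α₁ α₂, (if Cross z α₁ α₂ then c₁ α₁ * c₂ α₂ else 0) * unitValue χ (Ideal.Quotient.mk 𝔮 (α₁ * α₂)) =
      dcrossInd T Zv α₁ α₂ * (c₁ α₁ * c₂ α₂) * unitValue χ (Ideal.Quotient.mk 𝔮 (α₁ * α₂)) +
      (crossInd z α₁ α₂ - dcrossInd T Zv α₁ α₂) * (c₁ α₁ * c₂ α₂) * unitValue χ (Ideal.Quotient.mk 𝔮 (α₁ * α₂)) := by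
    intro α₁ α₂; rw [ite_cross_eq]; ring
  have hsum : ∑ α₁ ∈ A₁, ∑ α₂ ∈ A₂, (if Cross z α₁ α₂ then c₁ α₁ * c₂ α₂ else 0) *
        unitValue χ (Ideal.Quotient.mk 𝔮 (α₁ * α₂)) =
      (∑ α₁ ∈ A₁, ∑ α₂ ∈ A₂, dcrossInd T Zv α₁ α₂ * (c₁ α₁ * c₂ α₂) * unitValue χ (Ideal.Quotient.mk 𝔮 (α₁ * α₂))) +
      ∑ α₁ ∈ A₁, ∑ α₂ ∈ A₂, (crossInd z α₁ α₂ - dcrossInd T Zv α₁ α₂) * (c₁ α₁ * c₂ α₂) *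
        unitValue χ (Ideal.Quotient.mk 𝔮 (α₁ * α₂)) := by
    rw [← Finset.sum_add_distrib]
    refine Finset.sum_congr rfl fun α₁ _ => ?_
    rw [← Finset.sum_add_distrib]
    exact Finset.sum_congr rfl fun α₂ _ => hsplit α₁ α₂
  rw [hsum]
  refine (norm_add_le _ _).trans (add_le_add ?_ (norm_sum_sum_shell_le χ A₁ A₂ hz hT h₁ h₂ c₁ c₂))
  rw [sum_sum_dcrossInd_eq χ A₁ A₂ hPu hPz c₁ c₂]
  refine (norm_sum_le _ _).trans (Finset.sum_le_sum fun j hj => ?_)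
  rw [norm_mul, norm_mul]
  refine mul_le_mul_of_nonneg_right ?_ (by positivity)
  rw [norm_prod]
  refine Finset.prod_le_prod (fun k _ => norm_nonneg _) fun k _ => norm_sepCoeff_le ?_ (hPz k)
  exact Finset.mem_range.1 (Fintype.mem_piFinset.1 hj k)

omit [IsTotallyReal K] in
/-- `(N𝔮/φ(𝔮)) · #{primitive χ} ≤ N𝔮`. [folklore] -/
theorem weight_mul_card_primitive_le {𝔮 : Ideal (𝓞 K)} [Fintype (𝓞 K ⧸ 𝔮)] :
    (Ideal.absNorm 𝔮 : ℝ) / Fintype.card ((𝓞 K ⧸ 𝔮)ˣ) *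
        ((Finset.univ : Finset (AddChar (Additive ((𝓞 K ⧸ 𝔮)ˣ)) ℂ)).filter (IsPrimitiveChar 𝔮)).card ≤
      Ideal.absNorm 𝔮 := by
  haveI : Finite ((𝓞 K ⧸ 𝔮)ˣ) := inferInstance
  have hcard : (0 : ℝ) < Fintype.card ((𝓞 K ⧸ 𝔮)ˣ) := by exact_mod_cast Fintype.card_pos
  have hle : (((Finset.univ : Finset (AddChar (Additive ((𝓞 K ⧸ 𝔮)ˣ)) ℂ)).filter (IsPrimitiveChar 𝔮)).card : ℝ) ≤
      Fintype.card ((𝓞 K ⧸ 𝔮)ˣ) := by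
    have h1 := Finset.card_filter_le (Finset.univ : Finset (AddChar (Additive ((𝓞 K ⧸ 𝔮)ˣ)) ℂ)) (IsPrimitiveChar 𝔮)
    rw [Finset.card_univ] at h1
    have h2 : Fintype.card (AddChar (Additive ((𝓞 K ⧸ 𝔮)ˣ)) ℂ) ≤ Fintype.card (Additive ((𝓞 K ⧸ 𝔮)ˣ)) :=
      AddChar.card_addChar_le _ _
    rw [Fintype.card_congr (Additive.ofMul (α := (𝓞 K ⧸ 𝔮)ˣ)).symm] at h2
    exact_mod_cast h1.trans h2
  calc (Ideal.absNorm 𝔮 : ℝ) / Fintype.card ((𝓞 K ⧸ 𝔮)ˣ) *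
        ((Finset.univ : Finset (AddChar (Additive ((𝓞 K ⧸ 𝔮)ˣ)) ℂ)).filter (IsPrimitiveChar 𝔮)).card
      ≤ (Ideal.absNorm 𝔮 : ℝ) / Fintype.card ((𝓞 K ⧸ 𝔮)ˣ) * Fintype.card ((𝓞 K ⧸ 𝔮)ˣ) := by gcongr
    _ = Ideal.absNorm 𝔮 := by field_simp

omit [NumberField K] [IsTotallyReal K] in
/-- Weighted-sum bookkeeping: from `F χ ≤ ∑_j a_j G_j χ + s` (all `χ ∈ Pr`) and `w ≥ 0`,
`w ∑_χ F χ ≤ ∑_j a_j (w ∑_χ G_j χ) + w |Pr| s`. [folklore] -/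
theorem weighted_sum_le {X J : Type*} (Pr : Finset X) (Js : Finset J) {w s : ℝ} (hw : 0 ≤ w)
    (F : X → ℝ) (a : J → ℝ) (G : J → X → ℝ) (h : ∀ χ ∈ Pr, F χ ≤ (∑ j ∈ Js, a j * G j χ) + s) :
    w * ∑ χ ∈ Pr, F χ ≤ (∑ j ∈ Js, a j * (w * ∑ χ ∈ Pr, G j χ)) + w * Pr.card * s := by
  calc w * ∑ χ ∈ Pr, F χ ≤ w * ∑ χ ∈ Pr, ((∑ j ∈ Js, a j * G j χ) + s) :=
        mul_le_mul_of_nonneg_left (Finset.sum_le_sum h) hw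
    _ = (∑ j ∈ Js, a j * (w * ∑ χ ∈ Pr, G j χ)) + w * Pr.card * s := by
        rw [Finset.sum_add_distrib, Finset.sum_const, nsmul_eq_mul, mul_add, Finset.sum_comm, Finset.mul_sum]
        congr 1
        · refine Finset.sum_congr rfl fun j _ => ?_
          rw [Finset.mul_sum, Finset.mul_sum, Finset.mul_sum]
          exact Finset.sum_congr rfl fun χ _ => by ring
        · ring

omit [IsTotallyReal K] in
/-- **The per-modulus step of (3.12)**: for `𝔮 ≠ 0`,
`bTerm 𝔮 (cross form) ≤ ∑_j (∏γ_{j_k}) bTerm 𝔮 (d₁ⱼ ⊗ d₂ⱼ) + N𝔮 · shellSum`, with the twisted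
coefficients `d_iⱼ = c_i · t_j`. [cite: Hinz1988, §3 (3.12)] -/
theorem bTerm_cross_le {𝔮 : Ideal (𝓞 K)} (h𝔮 : 𝔮 ≠ ⊥) (A₁ A₂ : Finset (𝓞 K))
    {z : {w : InfinitePlace K // w.IsReal} → ℝ} (hz : ∀ k, 1 ≤ z k) {T : ℝ} (hT : 0 < T) {P : ℕ}
    (h₁ : ∀ α ∈ A₁, ∀ k, 1 ≤ remb K (α : K) k) (h₂ : ∀ α ∈ A₂, ∀ k, 1 ≤ remb K (α : K) k)
    (hPu : ∀ α₁ ∈ A₁, ∀ α₂ ∈ A₂, ∀ k, ulogV T α₁ k + ulogV T α₂ k < P) (hPz : ∀ k, ulogR T (z k) < P)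
    (c₁ c₂ : 𝓞 K → ℂ) :
    bTerm K 𝔮 A₁ A₂ (fun α₁ α₂ => if Cross z α₁ α₂ then c₁ α₁ * c₂ α₂ else 0) ≤
      (∑ j ∈ Fintype.piFinset (fun _ : {w : InfinitePlace K // w.IsReal} => Finset.range P),
        (∏ k, sepWeight P (j k)) *
          bTerm K 𝔮 A₁ A₂ (fun α₁ α₂ => (c₁ α₁ * sepPhase P j (ulogV T α₁)) * (c₂ α₂ * sepPhase P j (ulogV T α₂)))) +
        Ideal.absNorm 𝔮 * shellSum A₁ A₂ z T c₁ c₂ := by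
  haveI : Finite (𝓞 K ⧸ 𝔮) := Ideal.finiteQuotientOfFreeOfNeBot 𝔮 h𝔮
  haveI : Fintype (𝓞 K ⧸ 𝔮) := Fintype.ofFinite _
  haveI : Finite ((𝓞 K ⧸ 𝔮)ˣ) := inferInstance
  set w : ℝ := (Ideal.absNorm 𝔮 : ℝ) / Fintype.card ((𝓞 K ⧸ 𝔮)ˣ) with hw
  have hw0 : 0 ≤ w := by positivity
  set Pr := (Finset.univ : Finset (AddChar (Additive ((𝓞 K ⧸ 𝔮)ˣ)) ℂ)).filter (IsPrimitiveChar 𝔮) with hPr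
  set Js := Fintype.piFinset (fun _ : {w : InfinitePlace K // w.IsReal} => Finset.range P) with hJs
  have hχ : ∀ χ ∈ Pr, ‖∑ α₁ ∈ A₁, ∑ α₂ ∈ A₂, (if Cross z α₁ α₂ then c₁ α₁ * c₂ α₂ else 0) *
        unitValue χ (Ideal.Quotient.mk 𝔮 (α₁ * α₂))‖ ≤
      (∑ j ∈ Js, (∏ k, sepWeight P (j k)) *
        ‖∑ α₁ ∈ A₁, ∑ α₂ ∈ A₂, (c₁ α₁ * sepPhase P j (ulogV T α₁)) * (c₂ α₂ * sepPhase P j (ulogV T α₂)) *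
          unitValue χ (Ideal.Quotient.mk 𝔮 (α₁ * α₂))‖) + shellSum A₁ A₂ z T c₁ c₂ := by
    intro χ _
    have h0 := norm_cross_sum_le χ A₁ A₂ hz hT h₁ h₂ hPu hPz c₁ c₂
    refine h0.trans (le_of_eq (congrArg (fun t => t + shellSum A₁ A₂ z T c₁ c₂) ?_))
    refine Finset.sum_congr rfl fun j _ => congrArg (fun t => (∏ k, sepWeight P (j k)) * t) ?_
    rw [sum_sum_mul_unitValue_eq χ A₁ A₂ (fun α => c₁ α * sepPhase P j (ulogV T α))
      (fun α => c₂ α * sepPhase P j (ulogV T α)), norm_mul]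
  have hmain := weighted_sum_le Pr Js hw0
    (fun χ => ‖∑ α₁ ∈ A₁, ∑ α₂ ∈ A₂, (if Cross z α₁ α₂ then c₁ α₁ * c₂ α₂ else 0) *
        unitValue χ (Ideal.Quotient.mk 𝔮 (α₁ * α₂))‖)
    (fun j => ∏ k, sepWeight P (j k))
    (fun j χ => ‖∑ α₁ ∈ A₁, ∑ α₂ ∈ A₂, (c₁ α₁ * sepPhase P j (ulogV T α₁)) * (c₂ α₂ * sepPhase P j (ulogV T α₂)) *
          unitValue χ (Ideal.Quotient.mk 𝔮 (α₁ * α₂))‖) hχ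
  rw [bTerm_eq, ← hw, ← hPr]
  refine hmain.trans (add_le_add (le_of_eq ?_) ?_)
  · refine Finset.sum_congr rfl fun j _ => ?_
    rw [bTerm_eq, ← hw, ← hPr]
  · exact mul_le_mul_of_nonneg_right weight_mul_card_primitive_le (shellSum_nonneg A₁ A₂ z T c₁ c₂)

/-- **Hinz (3.12) — the bilinear large sieve with the box cross-condition** (totally real `K`,
cube boxes, separation without Perron): there is `C = C(K) > 0` such that for all `Q ≥ 1`, nonzero
`𝔞₁, 𝔞₂`, finite `A_i ⊆ 𝔞_i` in cubes of side `2X_i` with `N𝔞_i ≤ X_i^d` and all coordinates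
`σ_k(α) ≥ 1`, thresholds `z_k ≥ 1`, `T > 0`, `P` exceeding all `u_T(σ_k α₁) + u_T(σ_k α₂)` and
`u_T(z_k)`, and all coefficients `c₁, c₂`:
`∑_{N𝔮≤Q, (𝔮,𝔞₁𝔞₂)=1} (N𝔮/φ(𝔮)) ∑*_χ |∑∑_{σ_k(α₁)σ_k(α₂) ≤ z_k ∀k} c₁c₂ χ(α₁α₂)|`
`≤ C (2 + log P)^d √((Q²+X₁^d/N𝔞₁)∑|c₁|²) √((Q²+X₂^d/N𝔞₂)∑|c₂|²) + (∑_𝔮 N𝔮) ∑_{shell}|c₁||c₂|`.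
[cite: Hinz1988, §3 (3.12)] -/
theorem bilinearLargeSieve_hyperbolic : ∃ C : ℝ, 0 < C ∧ ∀ (Q : ℝ), 1 ≤ Q → ∀ (𝔞₁ 𝔞₂ : Ideal (𝓞 K)),
    𝔞₁ ≠ ⊥ → 𝔞₂ ≠ ⊥ → ∀ (A₁ A₂ : Finset (𝓞 K)), (∀ α ∈ A₁, α ∈ 𝔞₁) → (∀ α ∈ A₂, α ∈ 𝔞₂) →
    ∀ (cen₁ cen₂ : {w : InfinitePlace K // w.IsReal} → ℝ) (X₁ X₂ : ℝ), 0 < X₁ → 0 < X₂ →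
    (Ideal.absNorm 𝔞₁ : ℝ) ≤ X₁ ^ finrank ℚ K → (Ideal.absNorm 𝔞₂ : ℝ) ≤ X₂ ^ finrank ℚ K →
    (∀ α ∈ A₁, ∀ k, |remb K (α : K) k - cen₁ k| ≤ X₁) → (∀ α ∈ A₂, ∀ k, |remb K (α : K) k - cen₂ k| ≤ X₂) →
    (∀ α ∈ A₁, ∀ k, 1 ≤ remb K (α : K) k) → (∀ α ∈ A₂, ∀ k, 1 ≤ remb K (α : K) k) →
    ∀ (z : {w : InfinitePlace K // w.IsReal} → ℝ), (∀ k, 1 ≤ z k) → ∀ (T : ℝ), 0 < T → ∀ (P : ℕ),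
    (∀ α₁ ∈ A₁, ∀ α₂ ∈ A₂, ∀ k, ulogV T α₁ k + ulogV T α₂ k < P) → (∀ k, ulogR T (z k) < P) →
    ∀ (c₁ c₂ : 𝓞 K → ℂ),
    ∑ 𝔮 ∈ (idealsLE K Q).filter (fun 𝔮 => IsCoprime 𝔮 𝔞₁ ∧ IsCoprime 𝔮 𝔞₂),
        bTerm K 𝔮 A₁ A₂ (fun α₁ α₂ => if Cross z α₁ α₂ then c₁ α₁ * c₂ α₂ else 0) ≤
      C * (2 + Real.log P) ^ finrank ℚ K *
          Real.sqrt ((Q ^ 2 + X₁ ^ finrank ℚ K / Ideal.absNorm 𝔞₁) * ∑ α ∈ A₁, ‖c₁ α‖ ^ 2) *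
          Real.sqrt ((Q ^ 2 + X₂ ^ finrank ℚ K / Ideal.absNorm 𝔞₂) * ∑ α ∈ A₂, ‖c₂ α‖ ^ 2) +
        (∑ 𝔮 ∈ (idealsLE K Q).filter (fun 𝔮 => IsCoprime 𝔮 𝔞₁ ∧ IsCoprime 𝔮 𝔞₂), (Ideal.absNorm 𝔮 : ℝ)) *
          shellSum A₁ A₂ z T c₁ c₂ := by
  obtain ⟨C, hC, hB⟩ := bilinearLargeSieve (K := K)
  refine ⟨C, hC, ?_⟩
  intro Q hQ 𝔞₁ 𝔞₂ h𝔞₁ h𝔞₂ A₁ A₂ hA₁ hA₂ cen₁ cen₂ X₁ X₂ hX₁ hX₂ hN₁ hN₂ hbox₁ hbox₂ hpos₁ hpos₂ z hz T hT P hPu hPz c₁ c₂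
  haveI : Nonempty {w : InfinitePlace K // w.IsReal} :=
    Fintype.card_pos_iff.1 (by rw [card_realPlaces]; exact finrank_pos)
  have hP : 0 < P := by have := hPz (Classical.arbitrary _); omega
  set 𝒬 := (idealsLE K Q).filter (fun 𝔮 => IsCoprime 𝔮 𝔞₁ ∧ IsCoprime 𝔮 𝔞₂) with h𝒬
  have h𝒬0 : ∀ 𝔮 ∈ 𝒬, 𝔮 ≠ ⊥ := fun 𝔮 h => (mem_idealsLE.1 (Finset.mem_filter.1 h).1).1
  set Js := Fintype.piFinset (fun _ : {w : InfinitePlace K // w.IsReal} => Finset.range P) with hJs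
  set R : ℝ := C * Real.sqrt ((Q ^ 2 + X₁ ^ finrank ℚ K / Ideal.absNorm 𝔞₁) * ∑ α ∈ A₁, ‖c₁ α‖ ^ 2) *
      Real.sqrt ((Q ^ 2 + X₂ ^ finrank ℚ K / Ideal.absNorm 𝔞₂) * ∑ α ∈ A₂, ‖c₂ α‖ ^ 2) with hR
  -- the twisted forms obey (3.5) with the same right-hand side
  have hj : ∀ j ∈ Js, ∑ 𝔮 ∈ 𝒬, bTerm K 𝔮 A₁ A₂
      (fun α₁ α₂ => (c₁ α₁ * sepPhase P j (ulogV T α₁)) * (c₂ α₂ * sepPhase P j (ulogV T α₂))) ≤ R := by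
    intro j _
    have h := hB Q hQ 𝔞₁ 𝔞₂ h𝔞₁ h𝔞₂ A₁ A₂ hA₁ hA₂ cen₁ cen₂ X₁ X₂ hX₁ hX₂ hN₁ hN₂ hbox₁ hbox₂
      (fun α => c₁ α * sepPhase P j (ulogV T α)) (fun α => c₂ α * sepPhase P j (ulogV T α))
    simp only [norm_mul, norm_sepPhase, mul_one] at h
    rw [hR]; exact h
  -- sum the per-modulus step
  have hstep : ∀ 𝔮 ∈ 𝒬, bTerm K 𝔮 A₁ A₂ (fun α₁ α₂ => if Cross z α₁ α₂ then c₁ α₁ * c₂ α₂ else 0) ≤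
      (∑ j ∈ Js, (∏ k, sepWeight P (j k)) * bTerm K 𝔮 A₁ A₂
        (fun α₁ α₂ => (c₁ α₁ * sepPhase P j (ulogV T α₁)) * (c₂ α₂ * sepPhase P j (ulogV T α₂)))) +
        Ideal.absNorm 𝔮 * shellSum A₁ A₂ z T c₁ c₂ :=
    fun 𝔮 h𝔮 => bTerm_cross_le (h𝒬0 𝔮 h𝔮) A₁ A₂ hz hT hpos₁ hpos₂ hPu hPz c₁ c₂
  refine (Finset.sum_le_sum hstep).trans ?_
  rw [Finset.sum_add_distrib, ← Finset.sum_mul, Finset.sum_comm]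
  refine add_le_add ?_ le_rfl
  calc ∑ j ∈ Js, ∑ 𝔮 ∈ 𝒬, (∏ k, sepWeight P (j k)) * bTerm K 𝔮 A₁ A₂
        (fun α₁ α₂ => (c₁ α₁ * sepPhase P j (ulogV T α₁)) * (c₂ α₂ * sepPhase P j (ulogV T α₂)))
      = ∑ j ∈ Js, (∏ k, sepWeight P (j k)) * ∑ 𝔮 ∈ 𝒬, bTerm K 𝔮 A₁ A₂
        (fun α₁ α₂ => (c₁ α₁ * sepPhase P j (ulogV T α₁)) * (c₂ α₂ * sepPhase P j (ulogV T α₂))) :=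
        Finset.sum_congr rfl fun j _ => by rw [Finset.mul_sum]
    _ ≤ ∑ j ∈ Js, (∏ k, sepWeight P (j k)) * R :=
        Finset.sum_le_sum fun j hj' => mul_le_mul_of_nonneg_left (hj j hj') (Finset.prod_nonneg fun k _ => sepWeight_nonneg P _)
    _ = (∑ j ∈ Js, ∏ k, sepWeight P (j k)) * R := by rw [Finset.sum_mul]
    _ ≤ (2 + Real.log P) ^ finrank ℚ K * R := by
        refine mul_le_mul_of_nonneg_right ?_ (by rw [hR]; positivity)
        rw [← card_realPlaces K]
        exact sum_prod_sepWeight_le hP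
    _ = _ := by rw [hR]; ring

end Hyperbolic


end Literature.NumberTheory.Sieve.NumberFieldLS
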